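import Summits.Schanuel.Schanuel.Theorems.RootDecomp1KRadicalCells
import Summits.Schanuel.Schanuel.Theorems.RootDecomp1KDarkStorey
import Literature.Barriers.Schanuel.LargeTranscendenceDegree

/-!
# RootDecomp1K — «GENERIC CELLS» (lens 6 «barrier-complement carving», gen 13 = 1K ROUND 9, answer to the critic's FIRST ask (ii))

Route `route-Schanuel-RootDecomp1K` (DRAFT rev 8) is UNCHANGED by this file (no item, no `closes` edit).  Kernel-checked
support for crux A₄ʰ = `RootDecomp1K.HyperLiouvilleSchanuel` (stmt-Schanuel-33363), level `n = 3`.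

## What is new (the lever)

Rounds 5–8 decided the line-cells `z = (u, ρu, w)` (`ρ` hyper-Liouville, `w` arbitrary) ANCHOR CLASS BY ANCHOR CLASS,
each time through a transcendence MEASURE OF ONE NUMBER (`u` or `e^u`: torsion, Kummer `log α`, `e^β`, `log π`, fixed
points …).  The critic's round-9 verdict: the GENERIC anchor — `u` and `e^u` both unmeasured, e.g. `u = Σ b^{-k!}` — is the
frontier, and «every measure-based lever stops there».

This file removes the anchor hypothesis altogether.  The lever is NOT a measure of `u` or of `e^u` (none exists for a
generic `u`) but

* **(KS) Kummer specialisation of the transcendence-degree-2 locus.**  If `trdeg ℚ(u, e^u, ρ, e^{ρu}) = 2`, the point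
  `P₀ = (u, e^u, ρ, e^{ρu})` lies on a ℚ-surface `W ⊂ 𝔸⁴`; along the hyper-Liouville approximations `ρ ≈ p/q`
  (error `< exp(−q^m)`, EVERY `m`) it is `exp(−q^m)`-close to the point `P_q = (u, v^q, p/q, v^p)`, `v = e^{u/q}`, of the
  KUMMER SURFACE `V_{p,q} = {x₃ = p/q, x₂^p = x₄^q}`.  Eliminating along `V_{p,q}` (two resultants, degrees `≍ q`,
  the dark KERNEL of round 5 re-run with GROWING degree) produces algebraic `α ≈ e^u`, `β ≈ u` of degree and
  logarithmic height `≤ q^{O(1)}` with `|e^u − α| + |u − β| < exp(−q^m)` — UNLESS `W` is a cylinder `𝔸¹_{x₁} × Γ`.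
* **(NW) The universal pair measure.**  Nesterenko–Waldschmidt 1996 Theorem 1 bounds `|e^θ − α| + |θ − β|` below by
  `exp(−C·D³ log D · log A · log B)` for EVERY `θ ≠ 0` — POLYNOMIALLY in the degree `D`.  It is a measure of the PAIR
  `(θ, e^θ)` that needs no property of `θ`: against `exp(−q^m)` with `m` free it kills (KS)'s output.  (Round 5 used the same
  theorem only at FIXED degree — `WeakMeasure` — which is why it stopped at level 2.)  PROVED here: `expPair_lower_bound_of_NW1996Thm1`,
  `not_hyperPairApprox_of_NW1996Thm1`.
* **(CF) The cylinder funnel — measure-free.**  If `W = 𝔸¹ × Γ`, then `e^u` and `e^{ρu}` are both algebraic over `ℚ(ρ)`;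
  specialising `ρ = p/q` gives algebraic `y_q ≈ e^u`, `γ_q ≈ e^{ρu}` of BOUNDED degree with `γ_q^q = y_q^p` EXACTLY
  (Liouville's inequality), whence `y_q = δ_q^q` with `deg δ_q` bounded and `h(δ_q) = h(y_q)/q → 0`: Kronecker's theorem
  makes `δ_q`, hence `e^u`, a root of unity and then `ρ ∈ ℚ` — contradiction.  No transcendence measure at all.

Consequence (`hyperCell_any`, `sb_three_of_hlRatio`): modulo the registered fact NW96 Thm 1 and the two typed
pieces `KummerSpecialisation` (pure commutative algebra + root/height bookkeeping of the round-5 kernel) and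
`CylinderFunnel` (Liouville inequality + Kronecker), EVERY line-cell of A₄ʰ at `n = 3` has Schanuel's bound — for every
anchor `u ≠ 0`, generic dark ones included.  The level-3 storey of A₄ʰ is then EXACTLY (`level3_iff_rank3`) the
rank-3 residual `Rank3HyperResidual` (hyper-Liouville triples with NO hyper-Liouville coordinate ratio), and
`hyperLiouvilleSchanuel_live_of_pieces` assembles the live item from NW96 + KS + CF + Rank3 + the storey `n ≥ 4`.

WHY the known methods stop at the residual (§5, `not_technicalHypothesis_of_hyperLinLiouville`, hypothesis-free): every
hyper-Liouville point violates the Technical Hypothesis of Nesterenko–Philippon Ch. 14 Def. 2.6, under which ALL printed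
criteria for algebraic independence give large transcendence degree (catalogued barrier
`Literature.Barriers.Schanuel.LargeTranscendenceDegree`).  SHARPNESS (§6, hypothesis-free): `cylinderFunnel_sharp`,
`hyperTriple_sharp` — at `u = log 2`, `ρ = log 3 / log 2` (irrational, not hyper-Liouville) CF's conclusion and all
three triples of `hyperTriple` fail, so `HyperLiouville ρ` is load-bearing.  RUNGS of CF in the tree (§6): radical
anchors, `u = log 2` (mod NW96), `u = 2πi`; KS is moot at radical anchors.

Sorry-free; standard axioms (`propext`, `Classical.choice`, `Quot.sound`).  The five open pieces are tagged
`@[conjecture]` (obligation nodes); `HyperPairApprox`, `HyperPairApproxPoly`, `HasHLRatio` are predicates (untagged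
`def … : Prop`, like the tree's `HyperLiouville` / `HyperLinLiouville` / `FiniteTranscendenceType`).  Nothing here
proves Schanuel; rung 0.
-/


noncomputable section

open Complex IntermediateField Polynomial

namespace Summit.Schanuel.Schanuel.Theorems.RootDecomp1KGeneric

open Summit.Schanuel.Schanuel.Theorems.RootDecomp1KHyper (SB SFset sb_of_algebraicIndependent
  mem_adjoin_SFset_I')
open Summit.Schanuel.Schanuel.Theorems.RootDecomp1KHyper.HyperCell (HyperLiouville HyperLinLiouville
  pair_bounds HyperLiouville.ne_zero HyperLiouville.neg hyperLiouvilleSchanuel_live_of_three_le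
  algebraicIndependent_kummer algebraicIndependent_torsion)
open Summit.Schanuel.Schanuel.Theorems.RootDecomp1KRadical (FiniteTranscendenceType
  algebraicIndependent_radical)
open Literature.NumberTheory.Transcendental (NesterenkoWaldschmidt1996_thm_1 weilHeight₁)

/-! ## 1. The typed pieces -/

/-- **Hyper simultaneous approximation of the pair `(u, e^u)`** (NW-native form): for some exponent `C`
and every `m`, non-zero algebraic `α ≈ e^u`, `β ≈ u` with `[ℚ(α,β):ℚ] ≤ q^C`, `h(α), h(β) ≤ q^C`
(`h` = absolute logarithmic Weil height, as in NW96 Thm 1) and `|e^u − α| + |u − β| < exp(−q^m)`, `q ≥ m`.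
The OUTPUT of the Kummer specialisation; REFUTED for every `u ≠ 0` by NW96 Thm 1
(`not_hyperPairApprox_of_NW1996Thm1`).  A polynomial-data door is `hyperPairApprox_of_poly`. -/
def HyperPairApprox (u : ℂ) : Prop :=
  ∃ C : ℕ, ∀ m : ℕ, ∃ q : ℕ, m ≤ q ∧ ∃ α β : ℂ, α ≠ 0 ∧ β ≠ 0 ∧ IsAlgebraic ℚ α ∧ IsAlgebraic ℚ β ∧
    (Module.finrank ℚ ↥(IntermediateField.adjoin ℚ ({α, β} : Set ℂ)) : ℝ) ≤ (q : ℝ) ^ C ∧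
    weilHeight₁ (IntermediateField.adjoin ℚ ({α, β} : Set ℂ)) (fun _ : Unit => α) ≤ (q : ℝ) ^ C ∧
    weilHeight₁ (IntermediateField.adjoin ℚ ({α, β} : Set ℂ)) (fun _ : Unit => β) ≤ (q : ℝ) ^ C ∧
    ‖cexp u - α‖ + ‖u - β‖ < Real.exp (-((q : ℝ) ^ m))

/-- The size `Λ(f, S) = (deg S · deg f) · (1 + log M(S)) · (1 + log M(f))` of a pair of integer polynomials
(`M` = Mahler measure). -/
def pairSize (f S : ℤ[X]) : ℝ :=
  ((S.natDegree * f.natDegree : ℕ) : ℝ) * (1 + Real.log (S.map (Int.castRingHom ℂ)).mahlerMeasure) *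
    (1 + Real.log (f.map (Int.castRingHom ℂ)).mahlerMeasure)

/-- Polynomial-data form of `HyperPairApprox`: `β` a root of an irreducible `f ∈ ℤ[X]`, `α` a root of some
`S ∈ ℤ[X] ∖ 0`, `Λ(f, S) ≤ q^C`.  Implies the height form (`hyperPairApprox_of_poly`, via `pair_bounds`). -/
def HyperPairApproxPoly (u : ℂ) : Prop :=
  ∃ C : ℕ, ∀ m : ℕ, ∃ q : ℕ, m ≤ q ∧ ∃ (f S : ℤ[X]) (α β : ℂ), Irreducible f ∧ 0 < f.natDegree ∧ S ≠ 0 ∧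
    aeval β f = 0 ∧ aeval α S = 0 ∧ α ≠ 0 ∧ β ≠ 0 ∧ pairSize f S ≤ (q : ℝ) ^ C ∧
    ‖cexp u - α‖ + ‖u - β‖ < Real.exp (-((q : ℝ) ^ m))

/-- **Piece KS — KUMMER SPECIALISATION (typed; ATTACKABLE: the round-5 dark kernel run with GROWING degree).**
If `e^u, ρ, e^{ρu}` are algebraically DEPENDENT and `u` is ALGEBRAIC over `ℚ[e^u, ρ, e^{ρu}]` (i.e.
`trdeg ℚ(u, e^u, ρ, e^{ρu}) ≤ 2` off the cylinder case), then the hyper-Liouville approximations `ρ ≈ p/q`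
and the Kummer surface `x₂^p = x₄^q` through `(e^{u/q})^q = e^u`, `(e^{u/q})^p ≈ e^{ρu}` yield `HyperPairApprox u`.
Proof plan (memo §3): `P₁(e^u, ρ, e^{ρu}) = 0`, `P₁ ∈ ℤ[x₂,x₃,x₄] ∖ 0`; `r(V) := q^d P₁(V^q, p/q, V^p) ∈ ℤ[V]` is
`≢ 0` for `q` large (the exponents `qi + pk`, `i, k ≤ deg P₁ < q`, are pairwise distinct; `p/q` is not a root of
the coefficient polynomials once `q > denBound`, `den_lt_denBound`), has degree `≤ 2(ρ+1) q deg P₁` and length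
`≤ q^{O(1)}`, and `|r(e^{u/q})| < exp(−q^m/2)`; so (`exists_root_int_pow_le`) a root `γ` with `|e^{u/q} − γ|`, hence
`|e^u − γ^q|`, `< exp(−q^{m−2})`; `α := γ^q` (`resPoly`, `mahlerMeasure_resPoly_le`: degree `O(q)`, `log M = O(q log q)`).
Then `u` is a root of `Q(X; e^u, ρ, e^{ρu})`, `Q ∈ ℤ[X; x₂,x₃,x₄]` with `Q_top(e^u, ρ, e^{ρu}) ≠ 0`; the specialised
`s(X) := q^{d'} Q(X; γ^q, p/q, γ^p)` has leading coefficient `→ q^{d'} Q_top(e^u, ρ, e^{ρu}) ≠ 0` and `|s(u)|`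
hyper-small ⇒ a root `β` with `|u − β|` hyper-small; `β` is a root of `resPoly f_γ (…)` (`aeval_resPoly_eq_zero`),
sizes `q^{O(1)}` (`pair_bounds`).  Output: `HyperPairApproxPoly u`, hence `HyperPairApprox u`. -/
@[conjecture] def KummerSpecialisation : Prop :=
  ∀ (u : ℂ) (ρ : ℝ), u ≠ 0 → HyperLiouville ρ → 0 < ρ →
    ¬ AlgebraicIndependent ℚ ![cexp u, (ρ : ℂ), cexp (u * ρ)] →
    IsAlgebraic (Algebra.adjoin ℚ (Set.range ![cexp u, (ρ : ℂ), cexp (u * ρ)])) u →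
    HyperPairApprox u

/-- **Piece CF — CYLINDER FUNNEL (typed; ATTACKABLE and MEASURE-FREE: Liouville inequality + Kronecker).**
For `u ≠ 0` and `ρ > 0` hyper-Liouville, `ρ` is algebraically independent from `e^u` OR from `e^{ρu}`
(equivalently, `ρ` being transcendental: `e^u` and `e^{ρu}` are not both algebraic over `ℚ(ρ)`).
Proof plan (memo §4): with `A(ρ, e^u) = 0 = B(ρ, e^{ρu})` (`A, B ∈ ℤ[x][Y]`, wlog separable in `Y`), the roots
`y_q ≈ e^u` of `A(p/q, ·)` and `γ_q ≈ e^{ρu} ≈ (e^{u/q})^p` of `B(p/q, ·)` have BOUNDED degree and height `O(log q)`,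
and `|γ_q^q − y_q^p| < exp(−q^{m−1})` ⇒ `γ_q^q = y_q^p` EXACTLY (Liouville's inequality: a non-zero algebraic number
of degree `≤ d₀` and height `≤ O(q log q)` has modulus `≥ exp(−O(d₀ q log q))`) ⇒ `y_q = δ^q`, `γ_q = δ^p` with
`δ = γ_q^a y_q^b` (`ap + bq = 1`), `deg δ ≤ d₀`, `h(δ) = h(y_q)/q = O(log q / q)` ⇒ (Northcott + Kronecker:
Mathlib `Polynomial.finite_mahlerMeasure_le`, `pow_eq_one_of_mahlerMeasure_eq_one`) `δ` is a root of unity of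
bounded order for `q ≥ q₀` ⇒ `e^u`, hyper-close to `y_q ∈ μ_N`, lies in `μ_N` ⇒ `u ∈ 2πiℚ^×` ⇒ likewise
`e^{ρu} ∈ μ_N` ⇒ `ρ ∈ ℚ`: absurd.  RUNGS in the tree (§6): CF holds at every radical anchor (`e^u` of finite
transcendence type), at `u = log 2` and at `u = 2πi`.  SHARP in `ρ` (§6): the conclusion fails for the irrational
`ρ = log 3 / log 2` at `u = log 2` (`e^u = 2`, `e^{ρu} = 3`), so `HyperLiouville ρ` cannot be weakened to `Irrational ρ`. -/
@[conjecture] def CylinderFunnel : Prop :=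
  ∀ (u : ℂ) (ρ : ℝ), u ≠ 0 → HyperLiouville ρ → 0 < ρ →
    AlgebraicIndependent ℚ ![(ρ : ℂ), cexp u] ∨ AlgebraicIndependent ℚ ![(ρ : ℂ), cexp (u * ρ)]

/-- The WEAK cylinder funnel — all the assembly uses: CF under the extra hypothesis that `u` is transcendental
over `ℚ[e^u, ρ, e^{ρu}]` (the complementary case is Piece KS's). -/
@[conjecture] def CylinderFunnelWeak : Prop :=
  ∀ (u : ℂ) (ρ : ℝ), u ≠ 0 → HyperLiouville ρ → 0 < ρ →
    Transcendental (Algebra.adjoin ℚ (Set.range ![cexp u, (ρ : ℂ), cexp (u * ρ)])) u →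
    AlgebraicIndependent ℚ ![(ρ : ℂ), cexp u] ∨ AlgebraicIndependent ℚ ![(ρ : ℂ), cexp (u * ρ)]

/-- `CylinderFunnel` implies its restricted form `CylinderFunnelWeak` (the only form the assembly uses). -/
theorem cylinderFunnelWeak_of_cylinderFunnel (h : CylinderFunnel) : CylinderFunnelWeak :=
  fun u ρ hu hρ hρ0 _ => h u ρ hu hρ hρ0

/-! ## 2. Piece NW, PROVED: the universal pair measure (NW96 Thm 1) refutes `HyperPairApprox u` for every `u ≠ 0` -/

/-- The Mahler measure of a non-zero integer polynomial (mapped to `ℂ`) is at least `1`. -/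
private theorem one_le_mahlerMeasure_map_of_ne_zero {R : ℤ[X]} (hR : R ≠ 0) :
    1 ≤ (R.map (Int.castRingHom ℂ)).mahlerMeasure := by
  refine one_le_mahlerMeasure_of_one_le_norm_leadingCoeff ?_
  rw [Polynomial.leadingCoeff_map_of_injective (RingHom.injective_int _), eq_intCast,
    Complex.norm_intCast]
  exact_mod_cast Int.one_le_abs (Polynomial.leadingCoeff_ne_zero.mpr hR)

/-- The constant of the pair measure: `211 · (43/10) · (12 + T)(4 + 3T) ≤ c_NW(T)`, `T = |u|`. -/
def cNW (T : ℝ) : ℝ := 908 * (12 + T) * (4 + 3 * T)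

/-- The Nesterenko–Waldschmidt constant `cNW T` is positive for `T ≥ 0`. -/
theorem cNW_pos {T : ℝ} (hT : 0 ≤ T) : 0 < cNW T := by unfold cNW; positivity

/-- `2 * Real.exp 1 < 6`. -/
private theorem two_e_lt_six : 2 * Real.exp 1 < 6 := by
  have := Real.exp_one_lt_d9; linarith

/-- **Piece NW (kernel).**  NW 1996 Theorem 1 as a measure of the PAIR `(u, e^u)`, valid for EVERY `u ≠ 0` and
POLYNOMIAL in the size: if `[ℚ(α,β):ℚ], h(α), h(β) ≤ L` (`L ≥ 1`) then
`|e^u − α| + |u − β| ≥ exp(−c_NW(|u|) · (1 + L)^6)`. -/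
theorem expPair_lower_bound_of_NW1996Thm1 (hNW : NesterenkoWaldschmidt1996_thm_1) {u : ℂ} (hu0 : u ≠ 0)
    {α β : ℂ} (hα0 : α ≠ 0) (hβ0 : β ≠ 0) (hα : IsAlgebraic ℚ α) (hβ : IsAlgebraic ℚ β) {L : ℝ}
    (hL1 : 1 ≤ L) (hD : (Module.finrank ℚ ↥(IntermediateField.adjoin ℚ ({α, β} : Set ℂ)) : ℝ) ≤ L)
    (hhα : weilHeight₁ (IntermediateField.adjoin ℚ ({α, β} : Set ℂ)) (fun _ : Unit => α) ≤ L)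
    (hhβ : weilHeight₁ (IntermediateField.adjoin ℚ ({α, β} : Set ℂ)) (fun _ : Unit => β) ≤ L) :
    Real.exp (-(cNW ‖u‖ * (1 + L) ^ 6)) ≤ ‖cexp u - α‖ + ‖u - β‖ := by
  set D : ℕ := Module.finrank ℚ (IntermediateField.adjoin ℚ ({α, β} : Set ℂ)) with hDdef
  have hD0 : (0 : ℝ) ≤ D := Nat.cast_nonneg D
  have hDΛ : (D : ℝ) ≤ 1 + L := by linarith
  have hΛ2 : (2 : ℝ) ≤ 1 + L := by linarith
  have hΛ0 : (0 : ℝ) ≤ 1 + L := by linarith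
  -- Theorem 1 at `θ = u`, `A = B = e · e^L`, `E = e`
  have hlogA : Real.log (Real.exp 1 * Real.exp L) = 1 + L := by
    rw [Real.log_mul (Real.exp_pos 1).ne' (Real.exp_pos L).ne', Real.log_exp, Real.log_exp]
  have hinvD : (1 : ℝ) / D ≤ 1 := by
    rcases Nat.eq_zero_or_pos D with h | h
    · rw [h]; norm_num
    · exact (div_le_one (by exact_mod_cast h)).mpr (by exact_mod_cast h)
  have hA : max (weilHeight₁ (IntermediateField.adjoin ℚ ({α, β} : Set ℂ)) (fun _ : Unit => α))
      (1 / (D : ℝ)) ≤ Real.log (Real.exp 1 * Real.exp L) := by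
    rw [hlogA]
    exact max_le (by linarith) (by linarith)
  have hB : weilHeight₁ (IntermediateField.adjoin ℚ ({α, β} : Set ℂ)) (fun _ : Unit => β) ≤
      Real.log (Real.exp 1 * Real.exp L) := by
    rw [hlogA]; linarith
  have hmain := hNW u α β (Real.exp 1 * Real.exp L) (Real.exp 1 * Real.exp L) (Real.exp 1) hu0 hα0 hβ0
    hα hβ (by positivity) (by positivity) le_rfl hA hB
  rw [← hDdef, Real.log_exp, hlogA, one_pow, div_one] at hmain
  refine le_trans (Real.exp_le_exp.mpr ?_) hmain
  rw [neg_le_neg_iff]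
  -- the three factors
  set T : ℝ := ‖u‖ with hT
  have hT0 : 0 ≤ T := norm_nonneg u
  have hlogD : Real.log D ≤ 1 + L := by
    rcases Nat.eq_zero_or_pos D with h | h
    · rw [h]; simp; linarith
    · have := Real.log_le_sub_one_of_pos (by exact_mod_cast h : (0 : ℝ) < D); linarith
  have hlogD0 : 0 ≤ Real.log D := Real.log_natCast_nonneg D
  have hlogΛ : Real.log (1 + L) ≤ 1 + L := by
    have := Real.log_le_sub_one_of_pos (by linarith : (0 : ℝ) < 1 + L); linarith
  have hlogΛ0 : 0 ≤ Real.log (1 + L) := Real.log_nonneg (by linarith)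
  have hlogD2 : Real.log ((D : ℝ) + 2) ≤ 1 + L := by
    have := Real.log_le_sub_one_of_pos (by linarith : (0 : ℝ) < D + 2); linarith
  have hlogD20 : 0 ≤ Real.log ((D : ℝ) + 2) := Real.log_nonneg (by linarith)
  have hmax1 : 1 ≤ max 1 T := le_max_left _ _
  have hlogE : Real.log (Real.exp 1 * max 1 T) ≤ 1 + T := by
    rw [Real.log_mul (Real.exp_pos 1).ne' (by linarith), Real.log_exp]
    have := Real.log_le_sub_one_of_pos (by linarith : (0 : ℝ) < max 1 T)
    have hmaxT : max 1 T ≤ 1 + T := max_le (by linarith) (by linarith)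
    linarith
  have hlogE0 : 0 ≤ Real.log (Real.exp 1 * max 1 T) := Real.log_nonneg
    (one_le_mul_of_one_le_of_one_le (by have := Real.add_one_le_exp (1 : ℝ); linarith) hmax1)
  have hTΛ : 2 * T ≤ T * (1 + L) := by nlinarith
  have hΛsq : 1 + L ≤ (1 + L) ^ 2 := by nlinarith
  have hDΛ2 : (D : ℝ) * (1 + L) ≤ (1 + L) ^ 2 := by nlinarith
  have f1 : (1 + L) + Real.log (1 + L) + 4 * Real.log D + 2 * Real.log (Real.exp 1 * max 1 T) + 10 ≤
      (12 + T) * (1 + L) := by nlinarith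
  have f1pos : 0 ≤ (1 + L) + Real.log (1 + L) + 4 * Real.log D +
      2 * Real.log (Real.exp 1 * max 1 T) + 10 := by positivity
  have f2 : (D : ℝ) * (1 + L) + 2 * Real.exp 1 * T + 6 * 1 ≤ (4 + 3 * T) * (1 + L) ^ 2 := by
    have b : 2 * Real.exp 1 * T ≤ 6 * T := mul_le_mul_of_nonneg_right two_e_lt_six.le hT0
    nlinarith
  have f2pos : 0 ≤ (D : ℝ) * (1 + L) + 2 * Real.exp 1 * T + 6 * 1 := by positivity
  have f3 : 33 / 10 * (D : ℝ) * Real.log ((D : ℝ) + 2) + 1 ≤ 43 / 10 * (1 + L) ^ 2 := by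
    have hm : (D : ℝ) * Real.log ((D : ℝ) + 2) ≤ (1 + L) * (1 + L) := mul_le_mul hDΛ hlogD2 hlogD20 hΛ0
    nlinarith
  have f3pos : 0 ≤ 33 / 10 * (D : ℝ) * Real.log ((D : ℝ) + 2) + 1 := by positivity
  have hprod : 211 * (D : ℝ) * ((1 + L) + Real.log (1 + L) + 4 * Real.log D +
        2 * Real.log (Real.exp 1 * max 1 T) + 10) *
        ((D : ℝ) * (1 + L) + 2 * Real.exp 1 * T + 6 * 1) *
        (33 / 10 * (D : ℝ) * Real.log ((D : ℝ) + 2) + 1) ≤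
      211 * (1 + L) * ((12 + T) * (1 + L)) * ((4 + 3 * T) * (1 + L) ^ 2) * (43 / 10 * (1 + L) ^ 2) := by
    gcongr
  have e : 211 * (1 + L) * ((12 + T) * (1 + L)) * ((4 + 3 * T) * (1 + L) ^ 2) * (43 / 10 * (1 + L) ^ 2) =
      (9073 / 10 * (12 + T) * (4 + 3 * T)) * (1 + L) ^ 6 := by ring
  have hc : (9073 / 10 * (12 + T) * (4 + 3 * T)) * (1 + L) ^ 6 ≤ cNW T * (1 + L) ^ 6 := by
    unfold cNW; gcongr; norm_num
  linarith [hprod, e, hc]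

/-- **Piece NW, conclusion (kernel).**  No `u ≠ 0` admits a hyper simultaneous approximation of `(u, e^u)`
(mod NW96 Thm 1): `exp(−c (1 + q^C)^6) ≤ |e^u − α| + |u − β| < exp(−q^m)` fails at `m = 6C + ⌈64c⌉ + 1`. -/
theorem not_hyperPairApprox_of_NW1996Thm1 (hNW : NesterenkoWaldschmidt1996_thm_1) {u : ℂ} (hu0 : u ≠ 0) :
    ¬ HyperPairApprox u := by
  rintro ⟨C, hC⟩
  set c : ℝ := cNW ‖u‖ with hcdef
  have hc0 : 0 < c := cNW_pos (norm_nonneg u)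
  obtain ⟨q, hmq, α, β, hα0, hβ0, hα, hβ, hD, hhα, hhβ, hdist⟩ := hC (6 * C + ⌈64 * c⌉₊ + 1)
  have hq1 : (1 : ℝ) ≤ q := by
    have : 1 ≤ q := le_trans (by omega) hmq
    exact_mod_cast this
  have hL1 : (1 : ℝ) ≤ (q : ℝ) ^ C := one_le_pow₀ hq1
  have hlow := expPair_lower_bound_of_NW1996Thm1 hNW hu0 hα0 hβ0 hα hβ hL1 hD hhα hhβ
  have hlt := hlow.trans_lt hdist
  rw [Real.exp_lt_exp, neg_lt_neg_iff] at hlt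
  -- `q^m < c (1 + q^C)^6 ≤ 64 c q^{6C}`, but `q^m ≥ q^{6C} · q > 64 c · q^{6C}`
  have hqc : 64 * c < q := by
    have h1 : ((6 * C + ⌈64 * c⌉₊ + 1 : ℕ) : ℝ) ≤ q := by exact_mod_cast hmq
    push_cast at h1
    have h2 := Nat.le_ceil (64 * c)
    have h3 : (0 : ℝ) ≤ (6 * C : ℕ) := by positivity
    push_cast at h3
    linarith
  have h6 : (1 + (q : ℝ) ^ C) ^ 6 ≤ (2 * (q : ℝ) ^ C) ^ 6 :=
    pow_le_pow_left₀ (by positivity) (by linarith) 6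
  have e6 : (2 * (q : ℝ) ^ C) ^ 6 = 64 * (q : ℝ) ^ (6 * C) := by
    rw [mul_pow, ← pow_mul, mul_comm C 6]; norm_num
  have hqm : (q : ℝ) ^ (6 * C) * q ≤ (q : ℝ) ^ (6 * C + ⌈64 * c⌉₊ + 1) := by
    rw [pow_add, pow_add, pow_one]
    have h1 : (1 : ℝ) ≤ (q : ℝ) ^ ⌈64 * c⌉₊ := one_le_pow₀ hq1
    calc (q : ℝ) ^ (6 * C) * q = (q : ℝ) ^ (6 * C) * 1 * q := by ring
      _ ≤ (q : ℝ) ^ (6 * C) * (q : ℝ) ^ ⌈64 * c⌉₊ * q := by gcongr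
  have hup : c * (1 + (q : ℝ) ^ C) ^ 6 ≤ 64 * c * (q : ℝ) ^ (6 * C) := by
    have := mul_le_mul_of_nonneg_left (h6.trans e6.le) hc0.le
    linarith
  have hlt2 : 64 * c * (q : ℝ) ^ (6 * C) < (q : ℝ) ^ (6 * C) * q := by
    rw [mul_comm ((q : ℝ) ^ (6 * C)) (q : ℝ)]
    exact mul_lt_mul_of_pos_right hqc (by positivity)
  linarith

/-- The size `pairSize f S` of a pair of non-zero integer polynomials is non-negative. -/
theorem pairSize_nonneg (f S : ℤ[X]) (hf : f ≠ 0) (hS : S ≠ 0) : 0 ≤ pairSize f S := by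
  have h1 := Real.log_nonneg (one_le_mahlerMeasure_map_of_ne_zero hS)
  have h2 := Real.log_nonneg (one_le_mahlerMeasure_map_of_ne_zero hf)
  unfold pairSize; positivity

/-- The polynomial door: `HyperPairApproxPoly u → HyperPairApprox u` (degree and heights of a pair of roots
are bounded by `Λ(f, S)`: `pair_bounds` of the round-5 kernel). -/
theorem hyperPairApprox_of_poly {u : ℂ} (h : HyperPairApproxPoly u) : HyperPairApprox u := by
  obtain ⟨C, hC⟩ := h
  refine ⟨C, fun m => ?_⟩
  obtain ⟨q, hmq, f, S, α, β, hf, hfd, hS, hβ, hα, hα0, hβ0, hsize, hdist⟩ := hC m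
  obtain ⟨hαalg, hβalg, hD1, hDle, hhα, hhβ⟩ := pair_bounds f hf hfd hβ S hS hα
  set MS : ℝ := (S.map (Int.castRingHom ℂ)).mahlerMeasure with hMSdef
  set Mf : ℝ := (f.map (Int.castRingHom ℂ)).mahlerMeasure with hMfdef
  have hlS0 : 0 ≤ Real.log MS := Real.log_nonneg (one_le_mahlerMeasure_map_of_ne_zero hS)
  have hlf0 : 0 ≤ Real.log Mf := Real.log_nonneg (one_le_mahlerMeasure_map_of_ne_zero hf.ne_zero)
  set N : ℕ := S.natDegree * f.natDegree with hNdef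
  have hN1 : (1 : ℝ) ≤ N := by exact_mod_cast hD1.trans hDle
  have hDN : (Module.finrank ℚ ↥(IntermediateField.adjoin ℚ ({α, β} : Set ℂ)) : ℝ) ≤ N := by
    exact_mod_cast hDle
  have hsz : pairSize f S = (N : ℝ) * (1 + Real.log MS) * (1 + Real.log Mf) := rfl
  have hNsz : (N : ℝ) ≤ pairSize f S := by
    rw [hsz]
    have : (N : ℝ) * 1 * 1 ≤ (N : ℝ) * (1 + Real.log MS) * (1 + Real.log Mf) := by
      gcongr <;> linarith
    linarith
  have hSsz : Real.log MS ≤ pairSize f S := by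
    rw [hsz]
    have : 1 * (1 + Real.log MS) * 1 ≤ (N : ℝ) * (1 + Real.log MS) * (1 + Real.log Mf) := by
      gcongr; linarith
    linarith
  have hfsz : Real.log Mf ≤ pairSize f S := by
    rw [hsz]
    have : 1 * 1 * (1 + Real.log Mf) ≤ (N : ℝ) * (1 + Real.log MS) * (1 + Real.log Mf) := by
      gcongr; linarith
    linarith
  exact ⟨q, hmq, α, β, hα0, hβ0, hαalg, hβalg, hDN.trans (hNsz.trans hsize),
    hhα.trans (hSsz.trans hsize), hhβ.trans (hfsz.trans hsize), hdist⟩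

/-- Piece NW in polynomial form: modulo NW96 Theorem 1, `HyperPairApproxPoly u` fails for every `u ≠ 0`. -/
theorem not_hyperPairApproxPoly_of_NW1996Thm1 (hNW : NesterenkoWaldschmidt1996_thm_1) {u : ℂ}
    (hu0 : u ≠ 0) : ¬ HyperPairApproxPoly u :=
  fun h => not_hyperPairApprox_of_NW1996Thm1 hNW hu0 (hyperPairApprox_of_poly h)

end Summit.Schanuel.Schanuel.Theorems.RootDecomp1KGeneric
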